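import Summits.KontsevichZagierPeriods.KontsevichZagierPeriods.Theorems.RootDecompRationalCubeDichotomyNashMultiGenP01

/-! # `RootDecompRationalCubeDichotomyNashMultiGenP02` — part 2/16 of the mechanical ≤385-line split of `NashEtaleMultiGen.lean`
(split by the decomp-kz census seat for landing; mathematics unchanged; part 2 continues part 1). -/

open Set MvPolynomial Filter Topology
open Literature.NumberTheory.Transcendental (IsSemialgebraicFunOn)
open Literature.ModelTheory.ExponentialFields (IsSemialgebraic isSemialgebraic_setOf_eval_pos
  isSemialgebraic_setOf_eval_ne_zero)

namespace Summit.KontsevichZagierPeriods.RootDecompRationalCubeDichotomy.Rung29430.MultiGen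
open Summit.KontsevichZagierPeriods.KontsevichZagierPeriods.Theses.RootDecompRationalCubeDichotomy
  (NashEtaleCover NashEtaleLocal PiRationalisation)
open Summit.KontsevichZagierPeriods.RootDecompRationalCubeDichotomy.Rung29430.NashEtaleLocalGlue
  (local_of_simple nashEtaleCover_of_nashEtaleLocal nashEtaleLocal_zero)
open Summit.KontsevichZagierPeriods.RootDecompRationalCubeDichotomy.Rung29430.NashEtaleLocalOne
  (analyticOnNhd_aeval_snoc)
open Summit.KontsevichZagierPeriods.RootDecompRationalCubeDichotomy.RungEtale.Etale
  (piRationalisation_of_nashEtaleCover)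

noncomputable section

/-- Evaluation of `q ∈ ℚ[x][w]` at a real point `(x, w)`. -/
def evP (n : ℕ) (x : Fin n → ℝ) (w : ℝ) : Polynomial (MvPolynomial (Fin n) ℚ) →ₐ[ℚ] ℝ :=
  Polynomial.aevalTower (MvPolynomial.aeval x : MvPolynomial (Fin n) ℚ →ₐ[ℚ] ℝ) w

/-- Auxiliary step `evP_apply`. [bookkeeping] -/
theorem evP_apply {n : ℕ} (x : Fin n → ℝ) (w : ℝ) (q : Polynomial (MvPolynomial (Fin n) ℚ)) :
    evP n x w q = q.eval₂ (MvPolynomial.aeval x : MvPolynomial (Fin n) ℚ →ₐ[ℚ] ℝ) w := rfl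

/-- Auxiliary step `evP_C`. [bookkeeping] -/
@[simp] theorem evP_C {n : ℕ} (x : Fin n → ℝ) (w : ℝ) (c : MvPolynomial (Fin n) ℚ) :
    evP n x w (Polynomial.C c) = MvPolynomial.aeval x c := Polynomial.aevalTower_C _ _ _

/-- Auxiliary step `evP_X`. [bookkeeping] -/
@[simp] theorem evP_X {n : ℕ} (x : Fin n → ℝ) (w : ℝ) :
    evP n x w Polynomial.X = w := Polynomial.aevalTower_X _ _

/-- Auxiliary step `fromPoly_C`. [bookkeeping] -/
@[simp] theorem fromPoly_C {n : ℕ} (c : MvPolynomial (Fin n) ℚ) :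
    fromPoly n (Polynomial.C c) = MvPolynomial.rename Fin.castSucc c := Polynomial.aevalTower_C _ _ _

/-- Auxiliary step `fromPoly_X`. [bookkeeping] -/
@[simp] theorem fromPoly_X {n : ℕ} :
    fromPoly n Polynomial.X = X (Fin.last n) := Polynomial.aevalTower_X _ _

/-- Auxiliary step `toPoly_X_castSucc`. [bookkeeping] -/
@[simp] theorem toPoly_X_castSucc {n : ℕ} (i : Fin n) :
    toPoly n (X (Fin.castSucc i)) = Polynomial.C (X i) := by
  simp [toPoly]

/-- Auxiliary step `toPoly_X_last`. [bookkeeping] -/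
@[simp] theorem toPoly_X_last {n : ℕ} :
    toPoly n (X (Fin.last n)) = Polynomial.X := by
  simp [toPoly]

/-- `fromPoly ∘ toPoly = id`. -/
theorem fromPoly_comp_toPoly (n : ℕ) : (fromPoly n).comp (toPoly n) = AlgHom.id ℚ _ := by
  refine MvPolynomial.algHom_ext fun i => ?_
  refine Fin.lastCases ?_ (fun j => ?_) i
  · simp
  · simp [MvPolynomial.rename_X]

/-- Auxiliary step `fromPoly_toPoly`. [bookkeeping] -/
theorem fromPoly_toPoly {n : ℕ} (P : MvPolynomial (Fin (n + 1)) ℚ) : fromPoly n (toPoly n P) = P := by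
  have := congrArg (fun φ : MvPolynomial (Fin (n + 1)) ℚ →ₐ[ℚ] MvPolynomial (Fin (n + 1)) ℚ => φ P)
    (fromPoly_comp_toPoly n)
  simpa using this

/-- Evaluation compatibility: `(fromPoly q)(x, w) = evP x w q`. -/
theorem aeval_snoc_comp_fromPoly {n : ℕ} (x : Fin n → ℝ) (w : ℝ) :
    (MvPolynomial.aeval (Fin.snoc x w : Fin (n + 1) → ℝ)).comp (fromPoly n) = evP n x w := by
  refine Polynomial.algHom_ext' (MvPolynomial.algHom_ext fun i => ?_) ?_
  · simp [Polynomial.CAlgHom, Function.comp_def]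
  · simp

/-- Auxiliary step `aeval_snoc_fromPoly`. [bookkeeping] -/
theorem aeval_snoc_fromPoly {n : ℕ} (x : Fin n → ℝ) (w : ℝ) (q : Polynomial (MvPolynomial (Fin n) ℚ)) :
    MvPolynomial.aeval (Fin.snoc x w : Fin (n + 1) → ℝ) (fromPoly n q) = evP n x w q := by
  have := congrArg (fun φ : Polynomial (MvPolynomial (Fin n) ℚ) →ₐ[ℚ] ℝ => φ q)
    (aeval_snoc_comp_fromPoly x w)
  simpa using this

/-- `∂/∂w` kills `ℚ[x]` … -/
theorem pderiv_last_rename_castSucc {n : ℕ} (p : MvPolynomial (Fin n) ℚ) :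
    MvPolynomial.pderiv (Fin.last n) (MvPolynomial.rename Fin.castSucc p) = 0 := by
  classical
  induction p using MvPolynomial.induction_on with
  | C a => simp
  | add p q hp hq => simp [hp, hq]
  | mul_X p i hp =>
    simp [hp, MvPolynomial.pderiv_X, (Fin.castSucc_lt_last i).ne]

/-- … and is the formal derivative in `w`: `∂_w (fromPoly q) = fromPoly q'`. -/
theorem pderiv_last_fromPoly {n : ℕ} (q : Polynomial (MvPolynomial (Fin n) ℚ)) :
    MvPolynomial.pderiv (Fin.last n) (fromPoly n q) = fromPoly n (Polynomial.derivative q) := by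
  classical
  induction q using Polynomial.induction_on' with
  | add p q hp hq => simp only [map_add, hp, hq]
  | monomial k a =>
    rw [← Polynomial.C_mul_X_pow_eq_monomial, Polynomial.derivative_C_mul_X_pow]
    simp only [map_mul, map_pow, fromPoly_C, fromPoly_X, Derivation.leibniz, Derivation.leibniz_pow,
      pderiv_last_rename_castSucc, MvPolynomial.pderiv_X_self, smul_eq_mul, nsmul_eq_mul, mul_one,
      mul_zero, add_zero, map_natCast]
    ring

/-! ### §4.2  A non-trivial polynomial relation for a semialgebraic function (any dimension) -/

/-- A `ℚ`-semialgebraic function of `n` variables satisfies a non-trivial relation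
`P(x, f x) = 0`, `0 ≠ P ∈ ℚ[x₁..xₙ, w]`: its graph has empty interior, hence lies in finitely many
proper zero sets (`IsSemialgebraic.subset_interior_union`).  (General-`n` form of the `n = 1`
/-- Auxiliary step `of`. [bookkeeping] -/
lemma of `Theorems/LiftingCriteriaCubeNashNormalFormPuiseuxAtlas.lean`.) [BCR1998 §2.8] -/
theorem exists_relation {n : ℕ} {S : Set (Fin n → ℝ)} {f : (Fin n → ℝ) → ℝ}
    (hf : IsSemialgebraicFunOn ℚ S f) :
    ∃ P : MvPolynomial (Fin (n + 1)) ℚ, P ≠ 0 ∧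
      ∀ x ∈ S, MvPolynomial.aeval (Fin.snoc x (f x) : Fin (n + 1) → ℝ) P = 0 := by
  classical
  set G : Set (Fin (n + 1) → ℝ) := {z | ∃ x ∈ S, z = Fin.snoc x (f x)} with hG_def
  have hG : IsSemialgebraic ℚ G := hf
  have hint : interior G = ∅ := by
    refine Set.eq_empty_iff_forall_notMem.mpr fun z hz => ?_
    obtain ⟨ε, hε, hball⟩ := Metric.mem_nhds_iff.mp (mem_interior_iff_mem_nhds.mp hz)
    obtain ⟨x, -, hzx⟩ := interior_subset hz
    set z' : Fin (n + 1) → ℝ := Function.update z (Fin.last n) (z (Fin.last n) + ε / 2) with hz'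
    have hz'ball : z' ∈ Metric.ball z ε := by
      rw [Metric.mem_ball, dist_pi_lt_iff hε]
      intro b
      by_cases hb : b = Fin.last n
      · subst hb
        rw [hz', Function.update_self, Real.dist_eq,
          show z (Fin.last n) + ε / 2 - z (Fin.last n) = ε / 2 by ring, abs_of_pos (by linarith)]
        linarith
      · rw [hz', Function.update_of_ne hb, dist_self]
        exact hε
    obtain ⟨x', -, hz'x⟩ := hball hz'ball
    have h1 : Fin.init z' = Fin.init z := by
      rw [hz']
      exact Fin.init_update_last _ _
    have hx : Fin.init z = x := by rw [hzx, Fin.init_snoc]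
    have hx' : Fin.init z' = x' := by rw [hz'x, Fin.init_snoc]
    have hxx' : x' = x := by rw [← hx', h1, hx]
    have hlast : z' (Fin.last n) = z (Fin.last n) := by
      rw [hz'x, hzx, Fin.snoc_last, Fin.snoc_last, hxx']
    rw [hz', Function.update_self] at hlast
    linarith
  obtain ⟨Q₀, hQ₀, hsub⟩ := hG.subset_interior_union
  rw [hint, Set.empty_union] at hsub
  refine ⟨∏ q ∈ Q₀, q, Finset.prod_ne_zero_iff.mpr fun q hq h0 => ?_, fun x hx => ?_⟩
  · obtain ⟨y, hy⟩ := hQ₀ q hq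
    exact hy (by rw [h0, map_zero])
  · have hz : (Fin.snoc x (f x) : Fin (n + 1) → ℝ) ∈ G := ⟨x, hx, rfl⟩
    obtain ⟨q, hq, hq0⟩ : ∃ q ∈ Q₀, MvPolynomial.aeval (Fin.snoc x (f x) : Fin (n + 1) → ℝ) q = 0 := by
      simpa only [Set.mem_iUnion, Set.mem_setOf_eq, exists_prop] using hsub hz
    rw [map_prod]
    exact Finset.prod_eq_zero hq hq0

/-- Polynomial form of the relation: a non-zero `q ∈ ℚ[x][w]` with `q(x, f x) = 0` on `S`. -/
theorem exists_relation_poly {n : ℕ} {S : Set (Fin n → ℝ)} {f : (Fin n → ℝ) → ℝ}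
    (hf : IsSemialgebraicFunOn ℚ S f) :
    ∃ q : Polynomial (MvPolynomial (Fin n) ℚ), q ≠ 0 ∧ ∀ x ∈ S, evP n x (f x) q = 0 := by
  obtain ⟨P, hP0, hP⟩ := exists_relation hf
  refine ⟨toPoly n P, fun h0 => hP0 ?_, fun x hx => ?_⟩
  · rw [← fromPoly_toPoly P, h0, map_zero]
  · rw [← aeval_snoc_fromPoly, fromPoly_toPoly]
    exact hP x hx

/-! ### §4.3  Rational boxes (open, convex, `ℚ`-semialgebraic neighbourhoods) -/

/-- The open box `∏ᵢ (aᵢ, bᵢ)` with rational corners. -/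
def ratBox {n : ℕ} (a b : Fin n → ℚ) : Set (Fin n → ℝ) :=
  Set.pi Set.univ fun i => Set.Ioo ((a i : ℚ) : ℝ) ((b i : ℚ) : ℝ)

/-- Auxiliary step `isOpen_ratBox`. [bookkeeping] -/
theorem isOpen_ratBox {n : ℕ} (a b : Fin n → ℚ) : IsOpen (ratBox a b) :=
  isOpen_set_pi Set.finite_univ fun _ _ => isOpen_Ioo

/-- Auxiliary step `isPreconnected_ratBox`. [bookkeeping] -/
theorem isPreconnected_ratBox {n : ℕ} (a b : Fin n → ℚ) : IsPreconnected (ratBox a b) :=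
  (convex_pi fun _ _ => convex_Ioo _ _).isPreconnected

/-- `ratBox` is `ℚ`-semialgebraic. [BCR1998 §2.2] -/
theorem isSemialgebraic_ratBox {n : ℕ} (a b : Fin n → ℚ) : IsSemialgebraic ℚ (ratBox a b) := by
  classical
  have h : ratBox a b = ⋂ i ∈ (Finset.univ : Finset (Fin n)),
      ({x : Fin n → ℝ | 0 < MvPolynomial.aeval x (X i - C (a i) : MvPolynomial (Fin n) ℚ)} ∩
        {x : Fin n → ℝ | 0 < MvPolynomial.aeval x (C (b i) - X i : MvPolynomial (Fin n) ℚ)}) := by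
    ext x
    simp [ratBox, sub_pos]
  rw [h]
  exact IsSemialgebraic.biInter _ _ fun i _ =>
    (isSemialgebraic_setOf_eval_pos _).inter (isSemialgebraic_setOf_eval_pos _)

/-- Auxiliary step `exists_ratBox_subset`. [bookkeeping] -/
theorem exists_ratBox_subset {n : ℕ} {U : Set (Fin n → ℝ)} (hU : IsOpen U) {x₀ : Fin n → ℝ}
    (hx₀ : x₀ ∈ U) : ∃ a b : Fin n → ℚ, x₀ ∈ ratBox a b ∧ ratBox a b ⊆ U := by
  obtain ⟨ε, hε, hball⟩ := Metric.isOpen_iff.mp hU x₀ hx₀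
  have ha : ∀ i, ∃ a : ℚ, x₀ i - ε < a ∧ (a : ℝ) < x₀ i := fun i =>
    exists_rat_btwn (by linarith)
  have hb : ∀ i, ∃ b : ℚ, x₀ i < b ∧ (b : ℝ) < x₀ i + ε := fun i =>
    exists_rat_btwn (by linarith)
  choose a ha using ha
  choose b hb using hb
  refine ⟨a, b, fun i _ => ⟨(ha i).2, (hb i).1⟩, fun y hy => hball ?_⟩
  rw [Metric.mem_ball, dist_pi_lt_iff hε]
  intro i
  have hyi := hy i (Set.mem_univ i)
  rw [Real.dist_eq, abs_sub_lt_iff]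
  constructor <;> linarith [hyi.1, hyi.2, (ha i).1, (hb i).2]

/-! ### §4.4  The theorem on the generic stratum -/

/-- `ℚ[x₁, …, xₙ]` (reducible abbreviation, no new structure). -/
abbrev PolyRing (n : ℕ) : Type := MvPolynomial (Fin n) ℚ

/-- `Frac ℚ[x₁, …, xₙ] = ℚ(x₁, …, xₙ)`. -/
abbrev FracField (n : ℕ) : Type := FractionRing (PolyRing n)

/-- A non-zero constant polynomial over a field is a unit. -/
theorem isUnit_of_natDegree_eq_zero {K : Type*} [Field K] {p : Polynomial K} (hp0 : p ≠ 0)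
    (h : p.natDegree = 0) : IsUnit p :=
  Polynomial.isUnit_iff_degree_eq_zero.mpr ((Polynomial.degree_eq_iff_natDegree_eq hp0).mpr h)

/-- Clearing denominators: every non-zero `D ∈ ℚ(x)[w]` is, up to a non-zero constant of `ℚ[x]`,
the image of a non-zero `D' ∈ ℚ[x][w]` of the same degree. -/
theorem exists_integer_multiple {n : ℕ} {K : Type*} [Field K] [Algebra (PolyRing n) K]
    [IsFractionRing (PolyRing n) K] (D : Polynomial K) (hD0 : D ≠ 0) :
    ∃ (D' : Polynomial (PolyRing n)) (c : PolyRing n), D' ≠ 0 ∧ c ≠ 0 ∧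
      D'.natDegree = D.natDegree ∧
      D'.map (algebraMap (PolyRing n) K) = Polynomial.C (algebraMap (PolyRing n) K c) * D := by
  have hRK : Function.Injective (algebraMap (PolyRing n) K) := IsFractionRing.injective _ _
  obtain ⟨c, hc, hcD⟩ := IsLocalization.integerNormalization_spec (nonZeroDivisors (PolyRing n)) D
  have hc0 : (c : PolyRing n) ≠ 0 := mem_nonZeroDivisors_iff_ne_zero.mp hc
  have hsm : c • D = Polynomial.C (algebraMap (PolyRing n) K c) * D := by
    rw [← Polynomial.smul_eq_C_mul, algebraMap_smul]
  have hD'0 : IsLocalization.integerNormalization (nonZeroDivisors (PolyRing n)) D ≠ 0 := fun h0 =>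
    hD0 (IsFractionRing.integerNormalization_eq_zero_iff.mp h0)
  refine ⟨_, c, hD'0, hc0, ?_, by rw [hcD, hsm]⟩
  rw [← Polynomial.natDegree_map_eq_of_injective hRK, hcD, hsm,
    Polynomial.natDegree_C_mul ((map_ne_zero_iff _ hRK).mpr hc0)]

/-- **Irreducibility of the minimal relation.**  On an open preconnected `S` where `g` is
analytic, a relation `q(x, g x) = 0` of minimal `w`-degree among all non-zero relations valid on
`S` is irreducible over `ℚ(x)`: a factorisation clears to `A'·B' = c·q` in `ℚ[x][w]`, so the
analytic functions `A'(x, g x)`, `B'(x, g x)` have product `0` on `S`, one of them vanishes on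
`S` (identity principle), and minimality forces the other factor to be constant. -/
theorem irreducible_of_minimal {n : ℕ} {K : Type*} [Field K] [Algebra (PolyRing n) K]
    [IsFractionRing (PolyRing n) K] {S : Set (Fin n → ℝ)} {g : (Fin n → ℝ) → ℝ}
    (hSo : IsOpen S) (hSpc : IsPreconnected S) (hSan : AnalyticOnNhd ℝ g S)
    {q : Polynomial (PolyRing n)} (hq0 : q ≠ 0) (hpos : 0 < q.natDegree)
    (hq : ∀ x ∈ S, evP n x (g x) q = 0)
    (hmin : ∀ q' : Polynomial (PolyRing n), q' ≠ 0 → (∀ x ∈ S, evP n x (g x) q' = 0) →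
      q.natDegree ≤ q'.natDegree) :
    Irreducible (q.map (algebraMap (PolyRing n) K)) := by
  classical
  have hRK : Function.Injective (algebraMap (PolyRing n) K) := IsFractionRing.injective _ _
  have hQdeg : (q.map (algebraMap (PolyRing n) K)).natDegree = q.natDegree :=
    Polynomial.natDegree_map_eq_of_injective hRK _
  have hQ0 : q.map (algebraMap (PolyRing n) K) ≠ 0 := (Polynomial.map_ne_zero_iff hRK).mpr hq0
  refine irreducible_iff.mpr ⟨fun hu => ?_, fun A B hAB => ?_⟩
  · have := Polynomial.natDegree_eq_zero_of_isUnit hu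
    omega
  · have hA0 : A ≠ 0 := by
      rintro rfl
      exact hQ0 (by rw [hAB, zero_mul])
    have hB0 : B ≠ 0 := by
      rintro rfl
      exact hQ0 (by rw [hAB, mul_zero])
    have hdegAB : A.natDegree + B.natDegree = q.natDegree := by
      rw [← hQdeg, hAB, Polynomial.natDegree_mul hA0 hB0]
    obtain ⟨A', ca, hA'0, hca0, hdegA, hcaA⟩ := exists_integer_multiple (n := n) A hA0
    obtain ⟨B', cb, hB'0, hcb0, hdegB, hcbB⟩ := exists_integer_multiple (n := n) B hB0
    -- `A' * B' = C (ca * cb) * q` in `ℚ[x][w]`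
    have hprod : A' * B' = Polynomial.C (ca * cb) * q := by
      apply Polynomial.map_injective _ hRK
      rw [Polynomial.map_mul, hcaA, hcbB, Polynomial.map_mul, Polynomial.map_C, hAB, map_mul,
        Polynomial.C_mul]
      ring
    -- the two analytic functions `α = A'(x, g x)`, `β = B'(x, g x)` have product zero on `S`
    have hαan : AnalyticOnNhd ℝ
        (fun x => MvPolynomial.aeval (Fin.snoc x (g x) : Fin (n + 1) → ℝ) (fromPoly n A')) S :=
      analyticOnNhd_aeval_snoc hSan (fromPoly n A')
    have hβan : AnalyticOnNhd ℝ
        (fun x => MvPolynomial.aeval (Fin.snoc x (g x) : Fin (n + 1) → ℝ) (fromPoly n B')) S :=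
      analyticOnNhd_aeval_snoc hSan (fromPoly n B')
    have hαβ : ∀ x ∈ S,
        MvPolynomial.aeval (Fin.snoc x (g x) : Fin (n + 1) → ℝ) (fromPoly n A') *
          MvPolynomial.aeval (Fin.snoc x (g x) : Fin (n + 1) → ℝ) (fromPoly n B') = 0 := by
      intro x hx
      rw [aeval_snoc_fromPoly, aeval_snoc_fromPoly, ← map_mul, hprod, map_mul, evP_C, hq x hx,
        mul_zero]
    by_cases hαS : ∀ x ∈ S, MvPolynomial.aeval (Fin.snoc x (g x) : Fin (n + 1) → ℝ) (fromPoly n A') = 0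
    · -- `A'` is a relation on `S`: `deg A ≥ deg q`, so `deg B = 0` and `B` is a unit
      have hmA : q.natDegree ≤ A.natDegree := by
        rw [← hdegA]
        exact hmin A' hA'0 fun x hx => by rw [← aeval_snoc_fromPoly]; exact hαS x hx
      have hBdeg : B.natDegree = 0 := by omega
      exact Or.inr (isUnit_of_natDegree_eq_zero hB0 hBdeg)
    · -- otherwise `β` vanishes near a point where `α ≠ 0`, hence on all of `S`
      push Not at hαS
      obtain ⟨z, hzS, hαz⟩ := hαS
      have hev : (fun x => MvPolynomial.aeval (Fin.snoc x (g x) : Fin (n + 1) → ℝ) (fromPoly n B'))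
          =ᶠ[𝓝 z] 0 := by
        filter_upwards [(hαan z hzS).continuousAt.eventually_ne hαz, hSo.mem_nhds hzS] with y hy1 hy2
        exact (mul_eq_zero.mp (hαβ y hy2)).resolve_left hy1
      have hβS := hβan.eqOn_zero_of_preconnected_of_eventuallyEq_zero hSpc hzS hev
      have hmB : q.natDegree ≤ B.natDegree := by
        rw [← hdegB]
        exact hmin B' hB'0 fun x hx => by rw [← aeval_snoc_fromPoly]; exact hβS hx
      have hAdeg : A.natDegree = 0 := by omega
      exact Or.inl (isUnit_of_natDegree_eq_zero hA0 hAdeg)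

/-- **Separability transported through the generic specialisation.**  If the coordinates of `x₀`
are algebraically independent over `ℚ`, `ℚ[x] → ℝ, x ↦ x₀` is injective and extends to the
fraction field; an irreducible (hence, in characteristic `0`, separable) `q` then has only simple
roots after specialisation: `q(x₀, w) = 0 ⟹ ∂_w q(x₀, w) ≠ 0`. -/
theorem evP_derivative_ne_zero {n : ℕ} {K : Type*} [Field K] [CharZero K] [Algebra (PolyRing n) K]
    [IsFractionRing (PolyRing n) K] {x₀ : Fin n → ℝ} (hind : AlgebraicIndependent ℚ x₀)
    {q : Polynomial (PolyRing n)} (hirr : Irreducible (q.map (algebraMap (PolyRing n) K)))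
    {w : ℝ} (hroot : evP n x₀ w q = 0) : evP n x₀ w (Polynomial.derivative q) ≠ 0 := by
  have hinj : Function.Injective
      ((MvPolynomial.aeval x₀ : PolyRing n →ₐ[ℚ] ℝ) : PolyRing n →+* ℝ) :=
    algebraicIndependent_iff_injective_aeval.mp hind
  have hcomp : (IsFractionRing.lift hinj : K →+* ℝ).comp (algebraMap (PolyRing n) K) =
      ((MvPolynomial.aeval x₀ : PolyRing n →ₐ[ℚ] ℝ) : PolyRing n →+* ℝ) :=
    IsLocalization.lift_comp _
  have hsep : (q.map ((MvPolynomial.aeval x₀ : PolyRing n →ₐ[ℚ] ℝ) : PolyRing n →+* ℝ)).Separable := by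
    rw [← hcomp, ← Polynomial.map_map]
    exact hirr.separable.map
  rw [evP_apply] at hroot ⊢
  have h := hsep.eval₂_derivative_ne_zero (RingHom.id ℝ) (x := w)
    (by rwa [Polynomial.eval₂_map, RingHom.id_comp])
  rwa [Polynomial.derivative_map, Polynomial.eval₂_map, RingHom.id_comp] at h

/-- **Defect 0 (generic points) — PROVED.**  If the coordinates of `x₀` are algebraically
independent over `ℚ`, every `ℚ`-Nash function near `x₀` has a ONE-generator étale presentation
(`LocalDataAt`) at `x₀`, with itself as the generator: the minimal relation `q ∈ ℚ[x][w]` of `g`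
on a rational box around `x₀` is irreducible over `ℚ(x)` (`irreducible_of_minimal`), hence has a
simple root at `(x₀, g x₀)` (`evP_derivative_ne_zero`), and the landed `local_of_simple`
packages the data. [BCR1998 Prop. 8.1.8; folklore] -/
theorem localDataAt_of_algebraicIndependent {n : ℕ} {g : (Fin n → ℝ) → ℝ} {U : Set (Fin n → ℝ)}
    (hU : IsOpen U) (hsa : IsSemialgebraicFunOn ℚ U g) (han : AnalyticOnNhd ℝ g U)
    {x₀ : Fin n → ℝ} (hx₀ : x₀ ∈ U) (hind : AlgebraicIndependent ℚ x₀) : LocalDataAt n g x₀ := by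
  classical
  -- a rational box `S ∋ x₀` inside `U`
  obtain ⟨a, b, hxS, hSU⟩ := exists_ratBox_subset hU hx₀
  have hSo : IsOpen (ratBox a b) := isOpen_ratBox a b
  have hSsa : IsSemialgebraicFunOn ℚ (ratBox a b) g := hsa.mono hSU (isSemialgebraic_ratBox a b)
  have hSan : AnalyticOnNhd ℝ g (ratBox a b) := han.mono hSU
  have hinj : Function.Injective (MvPolynomial.aeval x₀ : PolyRing n →ₐ[ℚ] ℝ) :=
    algebraicIndependent_iff_injective_aeval.mp hind
  -- relations in polynomial form, one of minimal degree
  have hrel : ∃ d : ℕ, ∃ q : Polynomial (PolyRing n), q ≠ 0 ∧ q.natDegree = d ∧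
      ∀ x ∈ ratBox a b, evP n x (g x) q = 0 := by
    obtain ⟨q, hq0, hq⟩ := exists_relation_poly hSsa
    exact ⟨_, q, hq0, rfl, hq⟩
  obtain ⟨q, hq0, hqm, hq⟩ := Nat.find_spec hrel
  have hmin : ∀ q' : Polynomial (PolyRing n), q' ≠ 0 → (∀ x ∈ ratBox a b, evP n x (g x) q' = 0) →
      q.natDegree ≤ q'.natDegree := fun q' h0 h => by
    rw [hqm]
    exact Nat.find_min' hrel ⟨q', h0, rfl, h⟩
  -- `deg q ≥ 1`: a degree-0 relation is a non-zero element of `ℚ[x]` vanishing at `x₀`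
  have hpos : 0 < q.natDegree := by
    by_contra hle
    have hm0 : q.natDegree = 0 := by omega
    have hqC : q = Polynomial.C (q.coeff 0) := Polynomial.eq_C_of_natDegree_eq_zero hm0
    have h1 : MvPolynomial.aeval x₀ (q.coeff 0) = 0 := by
      have := hq x₀ hxS
      rwa [hqC, evP_C] at this
    have h2 : q.coeff 0 = 0 := hinj (by rw [h1, map_zero])
    exact hq0 (by rw [hqC, h2, map_zero])
  have hirr := irreducible_of_minimal (K := FracField n) hSo (isPreconnected_ratBox a b) hSan hq0 hpos hq hmin
  have hder := evP_derivative_ne_zero hind hirr (hq x₀ hxS)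
  -- the landed implicit-function packaging
  refine local_of_simple hSo hSsa hSan hxS (fromPoly n q) (fun x hx => ?_) ?_
  · rw [aeval_snoc_fromPoly]
    exact hq x hx
  · rw [pderiv_last_fromPoly, aeval_snoc_fromPoly]
    exact hder

/-- The generic stratum gives even the multi-generator data (k = 1). -/
theorem multiGenData_of_algebraicIndependent {n : ℕ} {g : (Fin n → ℝ) → ℝ} {U : Set (Fin n → ℝ)}
    (hU : IsOpen U) (hsa : IsSemialgebraicFunOn ℚ U g) (han : AnalyticOnNhd ℝ g U)
    {x₀ : Fin n → ℝ} (hx₀ : x₀ ∈ U) (hind : AlgebraicIndependent ℚ x₀) : MultiGenData n 1 g x₀ :=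
  multiGenData_of_localDataAt (localDataAt_of_algebraicIndependent hU hsa han hx₀ hind)

end
end Summit.KontsevichZagierPeriods.RootDecompRationalCubeDichotomy.Rung29430.MultiGen
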